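import Literature.AlgebraicGeometry.Resolution.BlowupOffCentre
import Literature.AlgebraicGeometry.Resolution.GermsOfClosedSubsets
import Literature.AlgebraicGeometry.Resolution.BlowupDisjointCentreSplitting
import HarnessLib

/-!
# Containments between transforms of a blowing up are decided off the centre: the carried host is not contained in a
# strict transform of a boundary member unless it was contained downstairs

Topic: `Literature/AlgebraicGeometry/Resolution`. For a blowing up `τ : W′ → W` along `C` (`W` locally Noetherian), an
arbitrary ideal sheaf `D` (a «host») and a RADICAL ideal sheaf `B` (a boundary member) none of whose maximal points lies
on the centre `V(C)`: if a controlled transform `τᶜ(D, m) = (τ^*D : 𝓘_E^m)` is contained in the strict transform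
`⋃ₙ (τ^*B : 𝓘_Eⁿ)` of `B`, then already `D ⊆ B` downstairs. Reason: at a point `β′` over a maximal point `β` of `V(B)` —
off the centre, where `τ` is a local isomorphism (Görtz–Wedhorn I, Prop. 13.91 (3)) — both transforms are total
transforms (tree `BlowupOffCentre.lean`), so `D_β ⊆ B_β ⊆ 𝔪_β`, i.e. `β ∈ V(D)`; hence `V(B) ⊆ V(D)` (maximal points
specialise to every point) and `D ⊆ √D = 𝓘(V(D)) ⊆ 𝓘(V(B)) = B`. Contrapositive
(`IsBlowup.not_controlledTransform_le_strictTransformIdeal`): the clause «the carried host is contained in no member of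
the transformed boundary» of a weighted blow-up step (Bierstone–Grigoriev–Milman–Włodarczyk 2011, Def. 3.1.3 (4):
`E′ = σᶜ(E) ∪ {D}`; Kollár 2007, 3.30.2) follows from the same clause downstairs; the new exceptional member is
`CartierDivisorControlledTransform.lean`'s `IsBlowup.not_controlledTransform_le_comap_of_idealOrder_genericPoint_eq`.

* `IsBlowup.exists_eq_of_not_mem_support` — points off the centre lift along `τ`;
* `IsBlowup.stalkIdeal_le_of_comap_of_not_mem_support` — `(τ^*D)_{β′} ⊆ (τ^*B)_{β′}` off the centre gives `D_β ⊆ B_β`;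
* `le_of_support_subset_of_radical` — `V(B) ⊆ V(D)` and `B` radical give `D ⊆ B`;
* **`IsBlowup.le_of_controlledTransform_le_strictTransformIdeal`**, **`IsBlowup.not_controlledTransform_le_strictTransformIdeal`**.

Written for the HIRONAKA-L lane of cell res-hironaka (L W5.2, TargetsF5J v5.1 cons clause
«`∀ p ∈ ℬ′, ¬ controlledTransform τ C D′ m ≤ strictTransformIdeal τ C p.1`», (L-A) after-care) by res-D-pv-026.
Everything proved; no definitions.

## Sources

* U. Görtz, T. Wedhorn, *Algebraic Geometry I* (2nd ed. 2020), Prop. 13.91 (3) p. 414. [GortzWedhorn2020]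
* E. Bierstone, D. Grigoriev, P. Milman, J. Włodarczyk, arXiv:1206.3090, Def. 3.1.3 (4), §3.2.
  [BierstoneGrigorievMilmanWlodarczyk2011]
* J. Kollár, *Lectures on Resolution of Singularities* (2007), 3.30.2. [Kollar2007]
-/

noncomputable section

open CategoryTheory CategoryTheory.Limits AlgebraicGeometry TopologicalSpace IsLocalRing

namespace Literature.AlgebraicGeometry.Resolution

universe u

open Scheme.IdealSheafData

variable {W W' : Scheme.{u}} {τ : W' ⟶ W} {C : W.IdealSheafData}

/-- **Points off the centre lift along a blowing up** (it is an isomorphism, in particular surjective, over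
`W ∖ V(C)`). [cite: GortzWedhorn2020, Prop. 13.91 (3) p. 414] -/
theorem IsBlowup.exists_eq_of_not_mem_support (hτ : IsBlowup τ C) {β : W} (hβ : β ∉ (C.support : Set W)) :
    ∃ β' : W', τ β' = β := by
  haveI : IsIso (τ ∣_ centreCompl C) := hτ.isIso_compl
  obtain ⟨w, hw⟩ := (τ ∣_ centreCompl C).homeomorph.surjective ⟨β, hβ⟩
  refine ⟨w.1, ?_⟩
  have := congrArg Subtype.val hw
  simpa [morphismRestrict_base_coe] using this

/-- **Containment of total transforms off the centre descends**: if `τ β′ ∉ V(C)` and `(τ^*D)_{β′} ⊆ (τ^*B)_{β′}`, then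
`D_{τ β′} ⊆ B_{τ β′}` (the stalk map at `β′` is an isomorphism). [cite: GortzWedhorn2020, Prop. 13.91 (3) p. 414] -/
theorem IsBlowup.stalkIdeal_le_of_comap_of_not_mem_support (hτ : IsBlowup τ C) {D B : W.IdealSheafData} {β' : W'}
    (hβ : τ β' ∉ (C.support : Set W)) (h : stalkIdeal (D.comap τ) β' ≤ stalkIdeal (B.comap τ) β') :
    stalkIdeal D (τ β') ≤ stalkIdeal B (τ β') := by
  haveI := hτ.isIso_stalkMap_of_not_mem_support hβ
  have hbij : Function.Bijective (τ.stalkMap β').hom := ConcreteCategory.bijective_of_isIso (τ.stalkMap β')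
  rw [stalkIdeal_comap_eq_map_stalkMap, stalkIdeal_comap_eq_map_stalkMap] at h
  rw [← Ideal.comap_map_of_bijective (τ.stalkMap β').hom hbij (I := stalkIdeal D (τ β')),
    ← Ideal.comap_map_of_bijective (τ.stalkMap β').hom hbij (I := stalkIdeal B (τ β'))]
  exact Ideal.comap_mono h

/-- **`V(B) ⊆ V(D)` with `B` radical gives `D ⊆ B`** (`D ⊆ √D = 𝓘(V(D)) ⊆ 𝓘(V(B)) = B`).
[cite: BierstoneGrigorievMilmanWlodarczyk2011, §3.2] -/
theorem le_of_support_subset_of_radical {D B : W.IdealSheafData} (hB : B = vanishingIdeal B.support)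
    (h : (B.support : Set W) ⊆ D.support) : D ≤ B := by
  rw [hB]
  exact le_support_iff_le_vanishingIdeal.mp h

/-- **If a controlled transform of `D` lies in the strict transform of a radical `B` whose maximal points are off the
centre, then `D ⊆ B`** (`W` locally Noetherian; any weight `m`). At a lift `β′` of a maximal point `β` of `V(B)` both
transforms are total transforms, so `D_β ⊆ B_β ⊆ 𝔪_β`; maximal points specialise to every point of `V(B)`, whence
`V(B) ⊆ V(D)`. [cite: Kollar2007, 3.30.2] -/
theorem IsBlowup.le_of_controlledTransform_le_strictTransformIdeal [IsLocallyNoetherian W] (hτ : IsBlowup τ C)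
    {D B : W.IdealSheafData} (hB : B = vanishingIdeal B.support)
    (hmax : ∀ β ∈ maxPoints (B.support : Set W), β ∉ (C.support : Set W)) (m : ℕ)
    (h : controlledTransform τ C D m ≤ strictTransformIdeal τ C B) : D ≤ B := by
  haveI : IsLocallyNoetherian W' := hτ.isLocallyNoetherian
  refine le_of_support_subset_of_radical hB fun y hy => ?_
  -- a maximal point `β` of `V(B)` specialising to `y`, off the centre, and a lift `β'`
  obtain ⟨β, hβmax, hβy⟩ := exists_mem_maxPoints_specializes B.support.isClosed hy
  have hβC : β ∉ (C.support : Set W) := hmax β hβmax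
  have hβB : β ∈ B.support := maxPoints_subset _ hβmax
  obtain ⟨β', hβ'⟩ := hτ.exists_eq_of_not_mem_support hβC
  subst hβ'
  -- at `β'` both transforms are total transforms
  have h1 : stalkIdeal (D.comap τ) β' ≤ stalkIdeal (B.comap τ) β' := by
    rw [← hτ.stalkIdeal_controlledTransform_of_not_mem D m hβC, ← hτ.stalkIdeal_strictTransformIdeal_of_not_mem B hβC]
    exact stalkIdeal_mono h β'
  have h2 : stalkIdeal D (τ β') ≤ stalkIdeal B (τ β') := hτ.stalkIdeal_le_of_comap_of_not_mem_support hβC h1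
  -- so `β ∈ V(D)`, and `V(D)` is closed under specialisation
  have hβD : τ β' ∈ D.support :=
    (mem_support_iff_stalkIdeal_le D _).mpr (h2.trans ((mem_support_iff_stalkIdeal_le B _).mp hβB))
  exact D.support.isClosed.stableUnderSpecialization hβy hβD

/-- **The carried host is contained in no strict transform of a boundary member** (contrapositive): if `D ⊄ B`
downstairs, `B` radical with maximal points off the centre, then `τᶜ(D, m) ⊄ (strict transform of B)` for every
weight `m` — the clause «`∀ p ∈ ℬ′, ¬ τᶜ(D′, m) ≤ strictTransformIdeal τ C p.1`» of a weighted blow-up step.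
[cite: Kollar2007, 3.30.2] -/
theorem IsBlowup.not_controlledTransform_le_strictTransformIdeal [IsLocallyNoetherian W] (hτ : IsBlowup τ C)
    {D B : W.IdealSheafData} (hB : B = vanishingIdeal B.support)
    (hmax : ∀ β ∈ maxPoints (B.support : Set W), β ∉ (C.support : Set W)) (hDB : ¬ D ≤ B) (m : ℕ) :
    ¬ controlledTransform τ C D m ≤ strictTransformIdeal τ C B :=
  fun h => hDB (hτ.le_of_controlledTransform_le_strictTransformIdeal hB hmax m h)

end Literature.AlgebraicGeometry.Resolution

end
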